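import Literature.Analysis.FluidPDE.JiaSverak2014LocalRegularityProofs
import Literature.Analysis.FluidPDE.JiaSverak2014BootstrapLevels
import Literature.Analysis.FluidPDE.JiaSverak2014TimeLipschitz
import Literature.Analysis.FluidPDE.SmoothSliceTimeExtension
import Literature.Analysis.FluidPDE.NSSliceTimeLimit
import Literature.Analysis.FunctionSpaces.HolderLimitOfIncrements
import HarnessLib

/-!
# Jia–Šverák 2014, local higher regularity near the initial time: the proof

Analysis/FluidPDE proofs file (theorems only; no definitions, no named facts): the discharge
`jia_sverak_2014_local_higher_regularity_holds` of the named fact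
`Literature.Analysis.FluidPDE.jia_sverak_2014_local_higher_regularity`
(`JiaSverak2014LocalRegularity.lean`; H. Jia, V. Šverák, Invent. Math. 196 (2014) 233–265 =
arXiv:1204.0529, §4 proof of Thm 4.1 with §3 Thm 3.2: "since `u₀ ∈ C^∞(B₄(x₀))`, we can apply
Theorem 3.1 and some simple bootstrapping arguments to show … `‖∂ₜ∂ₓ^α u‖_{L^∞(B_{1/8}(x₀)×[0,T₂])}
≤ C(α,u₀)`, this is true for any `u ∈ 𝒩(u₀)`"), assembled from the parts (all in this directory):

* Thm 3.2 (`jia_sverak_2014_theorem_3_2_holds`): boundedness of `u` near `t = 0` on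
  `B(x₀, 7/12)` (a countable covering by the balls `B(y, 1/4)` of the Hölder statement);
* the a priori estimate of Lemma 3.1 (`apriori_unit_scale_slab`): the uniformly local energy;
* the levels of the bootstrap (`all_levels`): representatives `R(t) ∈ C^{n,γ}` of `u(t)` on
  `B(x₀, ρₙ)`, `ρₙ ↓ 1/8`, with universal constants;
* the time-Lipschitz bounds of the spatial derivatives from the equation (`time_lipschitz`);
* the extension of the smooth, time-Lipschitz slices from the full-measure set of good times to
  the closed interval (`SmoothSlices.exists_smooth_extension_of_lipschitz_time`).

## References

* H. Jia, V. Šverák, Invent. Math. 196 (2014) 233–265 = arXiv:1204.0529, §3 Thm 3.2 and p. 9,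
  §4 proof of Thm 4.1. Bib key `JiaSverak2014`.
* P. G. Lemarié-Rieusset, *The Navier–Stokes Problem in the 21st Century* (2016), Def. 14.1,
  Thm 14.4. Bib key `LemarieRieusset2016`.
-/

noncomputable section

open MeasureTheory TopologicalSpace Set Function Filter Metric
open _root_.Topology
open scoped ENNReal NNReal RealInnerProductSpace ContDiff

namespace Literature.Analysis.FluidPDE

open JiaSverak2014 Literature.Analysis.UnboundedOperators

/-- The datum bounds `‖u₀‖ ≤ A₀`, `‖Du₀‖ ≤ A₁` on `B(x₀,4)` give `|u₀| ≤ M` and the `(M, 1/2)`-Hölder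
bound on every `B(y, 2)` with `dist y x₀ < 1`, `M = 2|A₀| + |A₁|`. [folklore] -/
theorem datum_holder_of_bounds {u₀ : (EuclideanSpace ℝ (Fin 3)) → (EuclideanSpace ℝ (Fin 3))} {x₀ : EuclideanSpace ℝ (Fin 3)}
    {A : ℕ → ℝ} (hu₀ : ContDiffOn ℝ ∞ u₀ (ball x₀ 4))
    (hA : ∀ n : ℕ, ∀ x ∈ ball x₀ 4, ‖iteratedFDeriv ℝ n u₀ x‖ ≤ A n) {y : EuclideanSpace ℝ (Fin 3)} (hy : dist y x₀ < 1) :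
    (∀ x ∈ ball y 2, ‖u₀ x‖ ≤ (Real.toNNReal (2 * |A 0| + |A 1|) : ℝ)) ∧
      HolderOnWith (Real.toNNReal (2 * |A 0| + |A 1|)) (1 / 2 : ℝ≥0) u₀ (ball y 2) := by
  have hK0 : 0 ≤ 2 * |A 0| + |A 1| := by positivity
  have hcoe : ((Real.toNNReal (2 * |A 0| + |A 1|) : ℝ≥0) : ℝ) = 2 * |A 0| + |A 1| := Real.coe_toNNReal _ hK0
  have hsub : ball y 2 ⊆ ball x₀ 4 := fun x hx => by
    rw [mem_ball] at hx ⊢; linarith [dist_triangle x y x₀]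
  have h0 : ∀ x ∈ ball x₀ 4, ‖u₀ x‖ ≤ |A 0| := fun x hx => by
    have h := hA 0 x hx
    rw [norm_iteratedFDeriv_zero] at h
    exact h.trans (le_abs_self _)
  have hdiff : ∀ x ∈ ball x₀ 4, DifferentiableAt ℝ u₀ x := fun x hx =>
    (hu₀.differentiableOn (by simp)).differentiableAt (isOpen_ball.mem_nhds hx)
  have h1 : ∀ x ∈ ball x₀ 4, ‖fderiv ℝ u₀ x‖ ≤ |A 1| := fun x hx => by
    have h := hA 1 x hx
    rw [← norm_iteratedFDeriv_fderiv, norm_iteratedFDeriv_zero] at h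
    exact h.trans (le_abs_self _)
  have hlip : ∀ x ∈ ball x₀ 4, ∀ x' ∈ ball x₀ 4, ‖u₀ x - u₀ x'‖ ≤ |A 1| * ‖x - x'‖ := fun x hx x' hx' =>
    (convex_ball x₀ 4).norm_image_sub_le_of_norm_fderiv_le hdiff h1 hx' hx
  refine ⟨fun x hx => ?_, ?_⟩
  · rw [hcoe]; linarith [h0 x (hsub hx), abs_nonneg (A 1), abs_nonneg (A 0)]
  · refine FunctionSpaces.holderOnWith_of_norm_sub_le hK0 fun x hx x' hx' => ?_
    rw [dist_eq_norm]
    have hγ : ((1 / 2 : ℝ≥0) : ℝ) = 1 / 2 := by norm_num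
    rw [hγ]
    by_cases hd : ‖x - x'‖ ≤ 1
    · have hr : ‖x - x'‖ ≤ ‖x - x'‖ ^ (1 / 2 : ℝ) :=
        Real.self_le_rpow_of_le_one (norm_nonneg _) hd (by norm_num)
      calc ‖u₀ x - u₀ x'‖ ≤ |A 1| * ‖x - x'‖ := hlip x (hsub hx) x' (hsub hx')
        _ ≤ |A 1| * ‖x - x'‖ ^ (1 / 2 : ℝ) := mul_le_mul_of_nonneg_left hr (abs_nonneg _)
        _ ≤ (2 * |A 0| + |A 1|) * ‖x - x'‖ ^ (1 / 2 : ℝ) :=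
            mul_le_mul_of_nonneg_right (by linarith [abs_nonneg (A 0)]) (Real.rpow_nonneg (norm_nonneg _) _)
    · have hr : (1 : ℝ) ≤ ‖x - x'‖ ^ (1 / 2 : ℝ) := Real.one_le_rpow (not_le.1 hd).le (by norm_num)
      calc ‖u₀ x - u₀ x'‖ ≤ ‖u₀ x‖ + ‖u₀ x'‖ := norm_sub_le _ _
        _ ≤ |A 0| + |A 0| := add_le_add (h0 x (hsub hx)) (h0 x' (hsub hx'))
        _ ≤ (2 * |A 0| + |A 1|) * 1 := by linarith [abs_nonneg (A 1)]
        _ ≤ (2 * |A 0| + |A 1|) * ‖x - x'‖ ^ (1 / 2 : ℝ) := mul_le_mul_of_nonneg_left hr hK0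

set_option maxHeartbeats 20000000 in
/-- **Discharge of `jia_sverak_2014_local_higher_regularity`** (Jia–Šverák 2014, §4 proof of
Thm 4.1, general-data reading: local smoothness of the datum propagates to all spatial
derivatives of any local Leray solution, bounded and Lipschitz in time up to `t = 0`, near the
point). [cite: JiaSverak2014, §4 proof of Thm. 4.1 (claim for |x₀| = 8) with §3 Thm. 3.2] -/
theorem jia_sverak_2014_local_higher_regularity_holds : jia_sverak_2014_local_higher_regularity := by
  classical
  intro α A
  /- ## universal constants -/
  set γ : ℝ≥0 := 1 / 2 with hγdef
  have hγ0 : 0 < (γ : ℝ) := by rw [hγdef]; norm_num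
  have hγ1 : (γ : ℝ) < 1 := by rw [hγdef]; norm_num
  have hγ0' : 0 < γ := by exact_mod_cast hγ0
  have hγ1' : γ < 1 := by exact_mod_cast hγ1
  set M : ℝ≥0 := Real.toNNReal (2 * |A 0| + |A 1|) with hMdef
  -- Thm 3.2: boundedness near the initial time
  obtain ⟨T₃, hT₃, C₃, h32⟩ := jia_sverak_2014_theorem_3_2_holds α M γ hγ0' hγ1'
  set Kb : ℝ := max C₃ 0 with hKbdef
  have hKb : 0 ≤ Kb := le_max_right _ _
  -- the a priori estimate: horizon and energy
  obtain ⟨ε₀, hε₀, hε₀1, CD, hD⟩ := apriori_unit_scale_slab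
  set TD : ℝ := (ε₀ : ℝ) / (1 + (α : ℝ) ^ 2) with hTD
  have hTDpos : 0 < TD := by rw [hTD]; positivity
  have hTDε : TD ≤ ε₀ := by
    rw [hTD, div_le_iff₀ (by positivity)]; nlinarith [hε₀.le, sq_nonneg (α : ℝ)]
  have hTDα : TD * (α : ℝ) ^ 2 ≤ ε₀ := by
    rw [hTD, div_mul_eq_mul_div, div_le_iff₀ (by positivity)]; nlinarith [hε₀.le, sq_nonneg (α : ℝ)]
  set Tstar : ℝ := min 1 TD with hTstar
  have hTstar : 0 < Tstar := lt_min one_pos hTDpos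
  have hT1 : Tstar ≤ 1 := min_le_left _ _
  have hTα : Tstar ≤ TD := min_le_right _ _
  set αu : ℝ≥0 := 2 * (CD * α) with hαu
  -- datum bounds on `B(x₀, 1)`
  set Ad : ℕ → ℝ := fun k => |A k| with hAddef
  have hAd0 : ∀ k, 0 ≤ Ad k := fun k => abs_nonneg _
  -- levels and time-Lipschitz constants
  have hlev := fun n => all_levels M γ hγ0 hγ1 hKb αu hAd0 n
  choose Clev hClev0 hClev using hlev
  have hrad := fun n => levelRadius_facts n
  have hlipC := fun n => time_lipschitz n hγ0 hγ1 (ρ' := (1 / 8 : ℝ)) (ρ := 1 / 8 + (1 / 2) ^ (n + 2) / 16)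
    (by norm_num) (hrad (n + 1)).1 ((hrad (n + 2)).2.2.trans (by norm_num)) hKb αu (hClev0 (n + 2)) Ad
  choose L hL0 hL using hlipC
  -- the horizon
  set Th : ℝ := min T₃ Tstar with hTh
  have hTh : 0 < Th := lt_min hT₃ hTstar
  set T : ℝ := Th / 2 with hTdef
  have hT : 0 < T := by rw [hTdef]; positivity
  have hTTh : T < Th := by rw [hTdef]; linarith
  refine ⟨T, hT, fun n => max (max (Clev n) (|A n|)) (L n), ?_⟩
  intro u₀ x₀ T' u p hm₀ hdiv hα hdec hu₀ hA hT' hu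
  /- ## the datum -/
  have hu₀1 : ContDiffOn ℝ (⊤ : ℕ∞) u₀ (ball x₀ 1) := hu₀.mono (ball_subset_ball (by norm_num))
  have hAd : ∀ k, ∀ x ∈ ball x₀ 1, ‖iteratedFDeriv ℝ k u₀ x‖ ≤ Ad k := fun k x hx =>
    (hA k x (ball_subset_ball (by norm_num) hx)).trans (le_abs_self _)
  have hdat := fun (y : EuclideanSpace ℝ (Fin 3)) (hy : dist y x₀ < 1) => datum_holder_of_bounds hu₀ hA hy
  /- ## boundedness near the initial time on `B(x₀, 7/12)` -/
  set T₀ : ℝ := min T₃ T' with hT₀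
  have hT₀ : 0 < T₀ := lt_min hT₃ hT'
  obtain ⟨q, hq⟩ := TopologicalSpace.exists_dense_seq (EuclideanSpace ℝ (Fin 3))
  have hbd_k : ∀ k, q k ∈ ball x₀ (7 / 12) →
      ∀ᵐ z ∂(volume.restrict (Ioo 0 T₀ ×ˢ ball (q k) (1 / 4))), ‖u z.1 z.2‖ ≤ Kb := by
    intro k hk
    have hk1 : dist (q k) x₀ < 1 := (mem_ball.1 hk).trans (by norm_num)
    obtain ⟨hMk, hHk⟩ := hdat (q k) hk1
    obtain ⟨U, hUae, -, hUb, -⟩ := h32 u₀ (q k) T' u p hm₀ hdiv hα hdec hMk hHk hT' hu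
    rw [Filter.EventuallyEq, ae_restrict_iff' (measurableSet_Ioo.prod measurableSet_ball)] at hUae
    rw [ae_restrict_iff' (measurableSet_Ioo.prod measurableSet_ball)]
    filter_upwards [hUae] with z hz hzS
    have h := hUb z ⟨⟨hzS.1.1.le, hzS.1.2.le⟩, ball_subset_closedBall hzS.2⟩
    rw [hz hzS] at h
    exact h.trans (le_max_left _ _)
  have hbd0 : ∀ᵐ z ∂(volume.restrict (Ioo 0 T₀ ×ˢ ball x₀ (7 / 12))), ‖u z.1 z.2‖ ≤ Kb := by
    set s : ℕ → Set (ℝ × EuclideanSpace ℝ (Fin 3)) := fun k =>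
      if q k ∈ ball x₀ (7 / 12) then Ioo 0 T₀ ×ˢ ball (q k) (1 / 4) else ∅ with hs
    have hsk : ∀ k, ∀ᵐ z ∂(volume.restrict (s k)), ‖u z.1 z.2‖ ≤ Kb := by
      intro k
      by_cases hk : q k ∈ ball x₀ (7 / 12)
      · simp only [hs, hk, if_true]; exact hbd_k k hk
      · simp only [hs, hk, if_false, Measure.restrict_empty, ae_zero]; exact eventually_bot
    have hU : ∀ᵐ z ∂(volume.restrict (⋃ k, s k)), ‖u z.1 z.2‖ ≤ Kb := (ae_restrict_iUnion_iff s _).2 hsk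
    refine ae_restrict_of_ae_restrict_of_subset ?_ hU
    rintro ⟨t, x⟩ ⟨ht, hx⟩
    have hr : 0 < min (1 / 4 : ℝ) (7 / 12 - dist x x₀) := lt_min (by norm_num) (by rw [mem_ball] at hx; linarith)
    obtain ⟨k, hk⟩ := hq.exists_dist_lt x hr
    have hk1 : dist x (q k) < 1 / 4 := hk.trans_le (min_le_left _ _)
    have hk2 : q k ∈ ball x₀ (7 / 12) := by
      rw [mem_ball]
      have hk' : dist (q k) x < 7 / 12 - dist x x₀ := by
        rw [dist_comm]; exact hk.trans_le (min_le_right _ _)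
      linarith [dist_triangle (q k) x x₀]
    refine mem_iUnion.2 ⟨k, ?_⟩
    simp only [hs, hk2, if_true]
    exact ⟨ht, mem_ball.2 hk1⟩
  /- ## the restricted solution and its uniformly local energy -/
  set Tu : ℝ := min Tstar T' with hTu
  have hTupos : 0 < Tu := lt_min hTstar hT'
  have hTuT' : Tu ≤ T' := min_le_right _ _
  have hTuS : Tu ≤ Tstar := min_le_left _ _
  have hTu1 : Tu ≤ 1 := hTuS.trans hT1
  have huT : IsLocalLeraySolutionOn Tu 1 u₀ u p := hu.mono hTuT'
  obtain ⟨Gw, hGw, -⟩ := hu.uniformLocalGradient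
  have two_mul_ge : ∀ c : ℝ≥0∞, c ≤ 2 * c := fun c => by
    calc c = 1 * c := (one_mul _).symm
      _ ≤ 2 * c := by gcongr; norm_num
  have hα2 : ∀ y : EuclideanSpace ℝ (Fin 3), ∫⁻ x in ball y 1, ‖u₀ x‖ₑ ^ 2 ≤ 2 * (α : ℝ≥0∞) := fun y =>
    (hα y).trans (two_mul_ge _)
  have hTuα : Tu * (α : ℝ) ^ 2 ≤ (ε₀ : ℝ) :=
    (mul_le_mul_of_nonneg_right (hTuS.trans hTα) (sq_nonneg _)).trans hTDα
  obtain ⟨hEu, -, -⟩ := hD u₀ u p Gw α T' Tu hm₀ hu hGw hα2 hTupos hTuT' ((hTuS.trans hTα).trans hTDε) hTuα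
  have hαu_c : (αu : ℝ≥0∞) = 2 * ((CD * α : ℝ≥0) : ℝ≥0∞) := by rw [hαu]; push_cast; ring
  have hEu' : ∀ᵐ t ∂(volume.restrict (Ioo 0 Tu)), ∀ z : EuclideanSpace ℝ (Fin 3),
      ∫⁻ x in ball z 1, ‖u t x‖ₑ ^ 2 ≤ αu := by
    filter_upwards [hEu] with t ht z
    rw [hαu_c]; exact ht z
  /- ## the times -/
  set Ts : ℝ := min T T' with hTs
  have hTs0 : 0 < Ts := lt_min hT hT'
  set Tb' : ℝ := min Th T' with hTb'def
  have hTb'0 : 0 < Tb' := lt_min hTh hT'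
  have hTsTb' : Ts ≤ Tb' := min_le_min hTTh.le le_rfl
  have hTb'Tu : Tb' ≤ Tu := min_le_min (min_le_right _ _) le_rfl
  have hTb'T₀ : Tb' ≤ T₀ := min_le_min (min_le_left _ _) le_rfl
  have hTb'1 : Tb' ≤ 1 := (min_le_left _ _).trans ((min_le_right _ _).trans hT1)
  have hbdT : ∀ᵐ z ∂(volume.restrict (Ioo 0 Tb' ×ˢ ball x₀ (7 / 12))), ‖u z.1 z.2‖ ≤ Kb :=
    ae_restrict_of_ae_restrict_of_subset (Set.prod_mono (Ioo_subset_Ioo_right hTb'T₀) Subset.rfl) hbd0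
  set Tbj : ℕ → ℝ := fun j => Ts * (1 - (1 / 2) ^ (j + 1)) with hTbj
  have hpowj : ∀ j : ℕ, (0 : ℝ) < (1 / 2) ^ (j + 1) ∧ ((1 : ℝ) / 2) ^ (j + 1) ≤ 1 / 2 := fun j =>
    ⟨by positivity, by
      calc ((1 : ℝ) / 2) ^ (j + 1) ≤ (1 / 2) ^ 1 := pow_le_pow_of_le_one (by norm_num) (by norm_num) (by omega)
        _ = 1 / 2 := pow_one _⟩
  have hTbj0 : ∀ j, 0 < Tbj j := fun j => by
    simp only [hTbj]; exact mul_pos hTs0 (by linarith [(hpowj j).2])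
  have hTbjT : ∀ j, Tbj j < Ts := fun j => by
    simp only [hTbj]; nlinarith [(hpowj j).1, hTs0]
  have hTbjTb' : ∀ j, Tbj j < Tb' := fun j => (hTbjT j).trans_le hTsTb'
  have hexj : ∀ t, t < Ts → ∃ j, t < Tbj j := by
    intro t ht
    obtain ⟨j, hj⟩ := exists_pow_lt_of_lt_one (show 0 < (Ts - t) / Ts by exact div_pos (by linarith) hTs0)
      (show (1 / 2 : ℝ) < 1 by norm_num)
    refine ⟨j, ?_⟩
    simp only [hTbj]
    have h1 : ((1 : ℝ) / 2) ^ (j + 1) ≤ (1 / 2) ^ j := pow_le_pow_of_le_one (by norm_num) (by norm_num) (Nat.le_succ j)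
    have h2 : ((1 : ℝ) / 2) ^ (j + 1) < (Ts - t) / Ts := h1.trans_lt hj
    rw [lt_div_iff₀ hTs0] at h2
    nlinarith
  /- ## the representatives of all levels and their good time sets -/
  have hRex : ∀ n j, ∃ R : ℝ → (EuclideanSpace ℝ (Fin 3)) → (EuclideanSpace ℝ (Fin 3)),
      StronglyMeasurable (uncurry R) ∧ (∀ t, IsHolderField n (γ : ℝ) (Clev n) (R t)) ∧
        ∀ᵐ t ∂(volume.restrict (Ioo 0 (Tbj j))), ∀ᵐ x ∂(volume.restrict (ball x₀ (1 / 8 + (1 / 2) ^ n / 16))),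
          R t x = u t x := fun n j =>
    hClev n hm₀ huT (hTbj0 j) (hTbjTb' j) hTb'Tu hTb'1 (hdat x₀ (by simp)).1 (hdat x₀ (by simp)).2 hu₀1 hAd hbdT hEu'
  choose R hRm hRH hRu using hRex
  have hGex : ∀ n j, ∃ G : Set ℝ, G ⊆ Ioo 0 (Tbj j) ∧ (∀ᵐ t ∂(volume.restrict (Ioo 0 (Tbj j))), t ∈ G) ∧
      (∀ t ∈ G, ∀ s ∈ G, ∀ x ∈ ball x₀ (1 / 8),
        ‖iteratedFDeriv ℝ n (R (n + 2) j t) x - iteratedFDeriv ℝ n (R (n + 2) j s) x‖ ≤ L n * |t - s|) ∧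
      (∀ t ∈ G, ∀ x ∈ ball x₀ (1 / 8), ‖iteratedFDeriv ℝ n (R (n + 2) j t) x - iteratedFDeriv ℝ n u₀ x‖ ≤ L n * t) :=
    fun n j => hL n hm₀ huT (hTbj0 j) (hTbjTb' j).le hTb'Tu hu₀1 hAd hbdT hEu' (R (n + 2) j) (hRH (n + 2) j) (hRu (n + 2) j)
  choose G hGsub hGae hGlip hGdat using hGex
  /- ## the good set of times -/
  set 𝒢 : Set ℝ := {t | t ∈ Ioo 0 Ts ∧ ∀ n j, t < Tbj j →
    t ∈ G n j ∧ ∀ᵐ x ∂(volume.restrict (ball x₀ (1 / 8 + (1 / 2) ^ n / 16))), R n j t x = u t x} with h𝒢def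
  have h𝒢ae : ∀ᵐ t ∂(volume.restrict (Ioo 0 Ts)), t ∈ 𝒢 := by
    have h1 : ∀ n j, ∀ᵐ t ∂(volume.restrict (Ioo 0 Ts)), t < Tbj j →
        t ∈ G n j ∧ ∀ᵐ x ∂(volume.restrict (ball x₀ (1 / 8 + (1 / 2) ^ n / 16))), R n j t x = u t x := by
      intro n j
      have h := (hGae n j).and (hRu n j)
      rw [ae_restrict_iff' measurableSet_Ioo] at h ⊢
      filter_upwards [h] with t ht htI htj
      exact ht ⟨htI.1, htj⟩
    have h2 : ∀ᵐ t ∂(volume.restrict (Ioo 0 Ts)), ∀ n j, t < Tbj j →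
        t ∈ G n j ∧ ∀ᵐ x ∂(volume.restrict (ball x₀ (1 / 8 + (1 / 2) ^ n / 16))), R n j t x = u t x := by
      rw [ae_all_iff]; intro n; rw [ae_all_iff]; intro j; exact h1 n j
    filter_upwards [ae_restrict_mem measurableSet_Ioo, h2] with t ht1 ht2
    exact ⟨ht1, ht2⟩
  have h𝒢sub : 𝒢 ⊆ Ioo 0 Ts := fun t ht => ht.1
  -- consistency on `B(x₀, 1/8)`
  have hball : ∀ n, ball x₀ (1 / 8 : ℝ) ⊆ ball x₀ (1 / 8 + (1 / 2) ^ n / 16) := fun n =>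
    ball_subset_ball (by linarith [(hrad n).2.2, pow_pos (show (0 : ℝ) < 1 / 2 by norm_num) n])
  have hcons : ∀ t ∈ 𝒢, ∀ n j n' j', t < Tbj j → t < Tbj j' → EqOn (R n j t) (R n' j' t) (ball x₀ (1 / 8)) := by
    intro t ht n j n' j' hj hj'
    have h1 := (ht.2 n j hj).2
    have h2 := (ht.2 n' j' hj').2
    have h1' : ∀ᵐ x ∂(volume.restrict (ball x₀ (1 / 8))), R n j t x = u t x := ae_restrict_of_ae_restrict_of_subset (hball n) h1
    have h2' : ∀ᵐ x ∂(volume.restrict (ball x₀ (1 / 8))), R n' j' t x = u t x := ae_restrict_of_ae_restrict_of_subset (hball n') h2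
    have h12 : R n j t =ᵐ[volume.restrict (ball x₀ (1 / 8))] R n' j' t := by
      filter_upwards [h1', h2'] with x hx1 hx2; rw [hx1, hx2]
    exact Measure.eqOn_open_of_ae_eq h12 isOpen_ball (hRH n j t).continuous.continuousOn (hRH n' j' t).continuous.continuousOn
  -- the selector of an admissible `j`
  have hjsel : ∀ t, ∃ j : ℕ, t < Ts → t < Tbj j := fun t => by
    by_cases ht : t < Ts
    · obtain ⟨j, hj⟩ := hexj t ht; exact ⟨j, fun _ => hj⟩
    · exact ⟨0, fun h => absurd h ht⟩
  choose jsel hjsel using hjsel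
  -- the slices on the good times
  set W : ℝ → (EuclideanSpace ℝ (Fin 3)) → (EuclideanSpace ℝ (Fin 3)) := fun t => R 0 (jsel t) t with hWdef
  have hWR : ∀ t ∈ 𝒢, ∀ n j, t < Tbj j → EqOn (W t) (R n j t) (ball x₀ (1 / 8)) := fun t ht n j hj =>
    hcons t ht 0 (jsel t) n j (hjsel t ht.1.2) hj
  have hWD : ∀ t ∈ 𝒢, ∀ n j, t < Tbj j → ∀ k, ∀ x ∈ ball x₀ (1 / 8),
      iteratedFDeriv ℝ k (W t) x = iteratedFDeriv ℝ k (R n j t) x := by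
    intro t ht n j hj k x hx
    have heq : W t =ᶠ[𝓝 x] R n j t := by
      filter_upwards [isOpen_ball.mem_nhds hx] with y hy
      exact hWR t ht n j hj hy
    exact (heq.iteratedFDeriv ℝ k).eq_of_nhds
  have hWsmooth : ∀ t ∈ 𝒢, ContDiffOn ℝ (⊤ : ℕ∞) (W t) (ball x₀ (1 / 8)) := by
    intro t ht
    rw [contDiffOn_infty]
    intro N
    have hj := hjsel t ht.1.2
    exact ((hRH N (jsel t) t).contDiff.contDiffOn).congr fun y hy => hWR t ht N (jsel t) hj hy
  have hWC : ∀ k, ∀ t ∈ 𝒢, ∀ x ∈ ball x₀ (1 / 8), ‖iteratedFDeriv ℝ k (W t) x‖ ≤ Clev k := by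
    intro k t ht x hx
    rw [hWD t ht k (jsel t) (hjsel t ht.1.2) k x hx]
    exact (hRH k (jsel t) t).norm_le k le_rfl x
  have hWL : ∀ k, ∀ t ∈ 𝒢, ∀ s ∈ 𝒢, ∀ x ∈ ball x₀ (1 / 8),
      ‖iteratedFDeriv ℝ k (W t) x - iteratedFDeriv ℝ k (W s) x‖ ≤ L k * |t - s| := by
    intro k t ht s hs x hx
    obtain ⟨j, hj⟩ := hexj (max t s) (max_lt ht.1.2 hs.1.2)
    have hjt : t < Tbj j := (le_max_left _ _).trans_lt hj
    have hjs : s < Tbj j := (le_max_right _ _).trans_lt hj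
    rw [hWD t ht (k + 2) j hjt k x hx, hWD s hs (k + 2) j hjs k x hx]
    exact hGlip k j t (ht.2 k j hjt).1 s (hs.2 k j hjs).1 x hx
  have hWdat : ∀ k, ∀ t ∈ 𝒢, ∀ x ∈ ball x₀ (1 / 8), ‖iteratedFDeriv ℝ k (W t) x - iteratedFDeriv ℝ k u₀ x‖ ≤ L k * t := by
    intro k t ht x hx
    have hj := hjsel t ht.1.2
    rw [hWD t ht (k + 2) (jsel t) hj k x hx]
    exact hGdat k (jsel t) t (ht.2 k (jsel t) hj).1 x hx
  /- ## the extension to the closed interval -/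
  set S : Set ℝ := insert 0 𝒢 with hSdef
  set W0 : ℝ → (EuclideanSpace ℝ (Fin 3)) → (EuclideanSpace ℝ (Fin 3)) := fun s => if s = 0 then u₀ else W s with hW0def
  have h𝒢ne : ∀ s ∈ 𝒢, s ≠ 0 := fun s hs => hs.1.1.ne'
  have hW0𝒢 : ∀ s ∈ 𝒢, W0 s = W s := fun s hs => by simp only [hW0def, h𝒢ne s hs, if_false]
  have hW00 : W0 0 = u₀ := by simp only [hW0def, if_true]
  set Ck : ℕ → ℝ := fun k => max (Clev k) (|A k|) with hCk
  have hB4 : ball x₀ (1 / 8 : ℝ) ⊆ ball x₀ 4 := ball_subset_ball (by norm_num)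
  have hSW : ∀ s ∈ S, ContDiffOn ℝ (⊤ : ℕ∞) (W0 s) (ball x₀ (1 / 8)) := by
    intro s hs
    rcases mem_insert_iff.1 hs with rfl | hs'
    · rw [hW00]; exact hu₀.mono hB4
    · rw [hW0𝒢 s hs']; exact hWsmooth s hs'
  have hSC : ∀ k, ∀ s ∈ S, ∀ x ∈ ball x₀ (1 / 8), ‖iteratedFDeriv ℝ k (W0 s) x‖ ≤ Ck k := by
    intro k s hs x hx
    rcases mem_insert_iff.1 hs with rfl | hs'
    · rw [hW00]; exact ((hA k x (hB4 hx)).trans (le_abs_self _)).trans (le_max_right _ _)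
    · rw [hW0𝒢 s hs']; exact (hWC k s hs' x hx).trans (le_max_left _ _)
  have hSL : ∀ k, ∀ s ∈ S, ∀ s' ∈ S, ∀ x ∈ ball x₀ (1 / 8),
      ‖iteratedFDeriv ℝ k (W0 s) x - iteratedFDeriv ℝ k (W0 s') x‖ ≤ L k * |s - s'| := by
    intro k s hs s' hs' x hx
    rcases mem_insert_iff.1 hs with rfl | hsg
    · rcases mem_insert_iff.1 hs' with rfl | hs'g
      · simp
      · rw [hW00, hW0𝒢 s' hs'g, norm_sub_rev, zero_sub, abs_neg, abs_of_pos hs'g.1.1]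
        exact hWdat k s' hs'g x hx
    · rcases mem_insert_iff.1 hs' with rfl | hs'g
      · rw [hW00, hW0𝒢 s hsg, sub_zero, abs_of_pos hsg.1.1]
        exact hWdat k s hsg x hx
      · rw [hW0𝒢 s hsg, hW0𝒢 s' hs'g]
        exact hWL k s hsg s' hs'g x hx
  obtain ⟨U, hUS, hUsm, hUC, hUL, hUcont⟩ :=
    SmoothSlices.exists_smooth_extension_of_lipschitz_time (isOpen_ball) hSW hSC hSL
  -- `[0, T_*] ⊆ closure S`
  have hIcc : Icc 0 Ts ⊆ closure S := by
    have h1 : Ioo 0 Ts ⊆ closure 𝒢 := subset_closure_of_ae_restrict_mem isOpen_Ioo h𝒢ae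
    have h2 : closure 𝒢 ⊆ closure S := closure_mono (subset_insert _ _)
    have h3 : closure (Ioo 0 Ts) ⊆ closure S := (closure_minimal (h1.trans h2) isClosed_closure)
    rwa [closure_Ioo hTs0.ne] at h3
  /- ## conclusion -/
  refine ⟨U, ?_, hUcont.mono (Set.prod_mono hIcc Subset.rfl), fun t ht => hUsm t (hIcc ht), fun x hx => ?_, ?_, ?_⟩
  · -- a.e. agreement with `u`
    have hf : AEStronglyMeasurable (uncurry U) (volume.restrict (Ioo 0 Ts ×ˢ ball x₀ (1 / 8))) :=
      (hUcont.mono (Set.prod_mono (Ioo_subset_Icc_self.trans hIcc) Subset.rfl)).aestronglyMeasurable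
        (measurableSet_Ioo.prod measurableSet_ball)
    have hg : AEStronglyMeasurable (uncurry u) (volume.restrict (Ioo 0 Ts ×ˢ ball x₀ (1 / 8))) :=
      hu.aestronglyMeasurable.mono_measure (Measure.restrict_mono
        (Set.prod_mono (Ioo_subset_Ioo_right (min_le_right _ _)) (subset_univ _)) le_rfl)
    refine ae_eq_restrict_prod_of_ae_ae hf hg ?_
    filter_upwards [h𝒢ae] with t ht
    have hj := hjsel t ht.1.2
    have h1 : ∀ᵐ x ∂(volume.restrict (ball x₀ (1 / 8))), R 0 (jsel t) t x = u t x :=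
      ae_restrict_of_ae_restrict_of_subset (hball 0) (ht.2 0 (jsel t) hj).2
    rw [ae_restrict_iff' measurableSet_ball] at h1 ⊢
    filter_upwards [h1] with x hx hxB
    show U t x = u t x
    rw [hUS t (mem_insert_of_mem _ ht) x hxB, hW0𝒢 t ht, ← hx hxB]
  · -- the datum
    rw [hUS 0 (mem_insert _ _) x hx, hW00]
  · -- bounds
    intro n t ht x hx
    calc ‖iteratedFDeriv ℝ n (U t) x‖ ≤ Ck n := hUC n t (hIcc ht) x hx
      _ ≤ max (max (Clev n) (|A n|)) (L n) := le_max_left _ _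
  · -- Lipschitz in time
    intro n t ht s hs x hx
    calc ‖iteratedFDeriv ℝ n (U t) x - iteratedFDeriv ℝ n (U s) x‖ ≤ L n * |t - s| := hUL n t (hIcc ht) s (hIcc hs) x hx
      _ ≤ max (max (Clev n) (|A n|)) (L n) * |t - s| := mul_le_mul_of_nonneg_right (le_max_right _ _) (abs_nonneg _)

end Literature.Analysis.FluidPDE
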